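import Literature.AnabelianGeometry.SemiGraphs.ArithLevelData
import Literature.AnabelianGeometry.SemiGraphs.TemperedMaximalCompact
import HarnessLib

/-!
# [SemiAnbd] Def 5.1 (i) / Prop 3.6 (iv) on the chart, BRANCH-GRANULAR form: `ArithChartBranchAction`

Mochizuki, *Semi-graphs of anabelioids*, Publ. RIMS **42** (2006), §5 pp. 62–66 (Def 5.1 (i),
Prop 5.2 (iv), p. 65, Thm 5.4), kurims `paper:url-f33ace170ff4`. [cite: MochizukiSemiAnbd2006, Def 5.1 (i), p. 62]

Third STATEMENTS file of sub-DAG `plan/L3/SUBDAG-SemiAnbd-Thm54.md` row T54-0 (PRODUCER,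
abc-iut-w4-d053), hosting abc-iut-w4-d040's clause (BR) (STATUS 2026-08-26, «THE ONE BRANCH-GRANULAR
CLAUSE THE LEVEL-A CONSUMERS NEED»; producer ACK 01:48:42Z; objection window 01:48–02:08Z, no
RESHAPE received).

WHY.  The landed hypothesis package `ArithChartAction c ι aug actV actE actB` (ArithLevelData.lean,
(S2b)) records Prop 3.6 (iv) at the automorphism `ρ(aug g)` of `𝒢` only VERTEX-wise and EDGE-wise:
`conj_verticial` / `conj_edgeLike` say that conjugation by `g ∈ Π^temp_𝔊` carries the §3 verticial
subgroups at `v` (edge-like subgroups at `e`) onto those at `(aug g) • v` (`(aug g) • e`) through `ι`.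
For a LOOP `e` at `u` the two hosts of an edge-like subgroup are both verticial at `u`, so the
vertex/edge-granular clauses cannot tell the two BRANCHES of `e` apart — although a morphism of
semi-graphs of anabelioids (here the automorphism `ρ(aug g)`, [SemiAnbd] Def 2.1 / Rmk 2.4.2:
`ProfiniteSemiGraph.Hom.comm`) is compatible with the branch maps `b_* : Π_e → Π_v` themselves, up to
conjugation.  The clause below records exactly this BRANCH-granular compatibility, read through the
chart: conjugation by `g` carries the PAIR (a host at `v` presented as `x · φ(Π_v) · x⁻¹` with `φ` a
verticial homomorphism, its `b`-branch group `x · φ(Π_b) · x⁻¹`, `Π_b ⊆ Π_v` the image of the edge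
group along the abutting branch `b`, `ProfiniteSemiGraph.branchSubgroup`) to the PAIR (a host at
`(aug g) • v`, its `((aug g) • b)`-branch group).  Over it abc-iut-w4-d040 derives at LEVEL A
(c1) `hconjPair` (abc-iut-w4-d029's binder of `ArithChartAction.verticialEdgeLikeCompactAmple`),
(c2) H-CE `C(ι L) ≤ C(ι H)` for edge-like `L ≤ H` verticial, (c3) `hcomm_b` / `hβ₂`; abc-iut-w4-d082
produces it for `Π^temp_𝔊 := π₁^temp(𝒢) ⋊^out Π_A` (ArithTemperedGroupOfOuterAction.lean) from the
branch-granular reading of Prop 3.6 (iv) at `ρ(a)`.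

WHAT IS HERE.
* `ProfiniteSemiGraph.ArithChartBranchAction c ι aug actV actE actB : Prop` — `ArithChartAction`
  EXTENDED by the one field `conj_branchPair` (abc-iut-w4-d040's text verbatim, except that the
  abutment `𝒢.graph.abuts ((aug g) • b) = some ((aug g) • v)` of the image branch is a BINDER `hb'`
  — consumers feed `hb' := A.abuts_actB (aug g) b v hb` — so that no field refers to another field);
  the projection `ArithChartBranchAction.toArithChartAction` comes with `extends`.
* `ProfiniteSemiGraph.arithChartBranchAction_trivial` — NON-VACUITY certificate: the package is
  inhabited by the trivial arithmetic situation `Π_A = 1`-action (`PA` arbitrary acting trivially,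
  `Gtp := π₁^temp(𝒢)`, `ι := id`), where conjugation by `g` carries the pair presented by `(φ, x)`
  to the pair presented by `(φ, g * x)` (private folklore helper `conjSubgroup_map_conj_map_id`).

A HYPOTHESIS PACKAGE (binders; nothing asserted, no instance, no new named fact): producing it for
the real `Π^temp_𝔊` is part of the booked producer-debt row T54-B (plan/GAP-LEDGER.md G-w4d053-1).
Nothing here asserts a statement of the paper; typed ≠ proved; no side taken on [IUTchIII] Cor 3.12.
-/

namespace Literature.AnabelianGeometry.SemiGraphs

open CategoryTheory Topology
open scoped Pointwise

universe u u' u''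

namespace ProfiniteSemiGraph

variable {𝒢 : ProfiniteSemiGraph.{u}}

/-- **Def 5.1 (i) on the tempered chart, branch-granular** ([SemiAnbd] §5 p. 62 with Prop 3.6 (iv)
p. 39 at the automorphisms `ρ(aug g)`, and the compatibility of morphisms of semi-graphs of
anabelioids with the branch maps `b_*`, Rmk 2.4.2 p. 26): the hypothesis package `ArithChartAction`
together with the clause `conj_branchPair` — "conjugation by `g ∈ Π^temp_𝔊` carries the pair
(host at `v` presented by `(φ, x)`, its `b`-branch group) to the pair (host at `(aug g) • v`, its
`((aug g) • b)`-branch group), through `ι`".  Binders only; nothing asserted.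
[cite: MochizukiSemiAnbd2006, Def 5.1 (i), p. 62] -/
structure ArithChartBranchAction (c : TemperedPiChart 𝒢) {Gtp : Type u'} [Group Gtp] (ι : c.G →* Gtp)
    {PA : Type u''} [Group PA] [TopologicalSpace PA] (aug : Gtp →* PA)
    (actV : PA → 𝒢.graph.Vertex → 𝒢.graph.Vertex) (actE : PA → 𝒢.graph.Edge → 𝒢.graph.Edge)
    (actB : PA → 𝒢.graph.Branch → 𝒢.graph.Branch) : Prop
    extends ArithChartAction c ι aug actV actE actB where
  /-- (BR): conjugation by `g` carries the pair (`x · φ(Π_v) · x⁻¹`, `x · φ(Π_b) · x⁻¹`) at the branch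
  `b` abutting to `v` to a pair (`x' · φ'(Π_{v'}) · x'⁻¹`, `x' · φ'(Π_{b'}) · x'⁻¹`) at the image branch
  `b' = (aug g) • b` abutting to `v' = (aug g) • v`, through `ι`; the abutment of `b'` to `v'` is the
  binder `hb'` (fed by `abuts_actB`). -/
  conj_branchPair : ∀ (g : Gtp) (b : 𝒢.graph.Branch) (v : 𝒢.graph.Vertex)
    (hb : 𝒢.graph.abuts b = some v) (φ : 𝒢.Gv v →ₜ* c.G), IsVerticialHom c v φ → ∀ (x : c.G)
    (hb' : 𝒢.graph.abuts (actB (aug g) b) = some (actV (aug g) v)),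
    ∃ φ' : 𝒢.Gv (actV (aug g) v) →ₜ* c.G, IsVerticialHom c (actV (aug g) v) φ' ∧
      ∃ x' : c.G,
        conjSubgroup g ((φ.toMonoidHom.range.map (MulAut.conj x).toMonoidHom).map ι) =
          (φ'.toMonoidHom.range.map (MulAut.conj x').toMonoidHom).map ι ∧
        conjSubgroup g
            ((((𝒢.branchSubgroup b v hb).map φ.toMonoidHom).map (MulAut.conj x).toMonoidHom).map ι) =
          (((𝒢.branchSubgroup (actB (aug g) b) (actV (aug g) v) hb').map φ'.toMonoidHom).map
            (MulAut.conj x').toMonoidHom).map ι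

/-! ### Non-vacuity: the trivial arithmetic situation inhabits the package -/

/-- Conjugating by `g` after conjugating by `x` is conjugating by `g * x`, on subgroups of
`π₁^temp(𝒢)` seen through `ι := id`. [folklore] -/
private theorem conjSubgroup_map_conj_map_id {Γ : Type u} [Group Γ] (g x : Γ) (K : Subgroup Γ) :
    conjSubgroup g ((K.map (MulAut.conj x).toMonoidHom).map (MonoidHom.id Γ)) =
      (K.map (MulAut.conj (g * x)).toMonoidHom).map (MonoidHom.id Γ) := by
  simp only [conjSubgroup, Subgroup.map_map]
  congr 1
  ext y
  simp [mul_assoc]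

/-- **Non-vacuity certificate**: for ANY topological group `Π_A` acting TRIVIALLY on the underlying
semi-graph, `Gtp := π₁^temp(𝒢)` with `ι := id` and any `aug`, the package `ArithChartBranchAction`
holds — conjugation by `g` carries the pair presented by `(φ, x)` to the pair presented by
`(φ, g * x)`, and conjugates of verticial (edge-like) subgroups are verticial (edge-like)
(`conj_mem_verticialSubgroups`, `conj_mem_edgeLikeSubgroups'`).  So the binders are jointly
satisfiable (nothing is derived from an inconsistent package).
[cite: MochizukiSemiAnbd2006, Def 5.1 (i), p. 62] -/
theorem arithChartBranchAction_trivial (c : TemperedPiChart 𝒢) {PA : Type u''} [Group PA]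
    [TopologicalSpace PA] (aug : c.G →* PA) :
    ArithChartBranchAction c (MonoidHom.id c.G) aug (fun _ v => v) (fun _ e => e) (fun _ b => b) where
  edgeOf_actB _ _ := rfl
  abuts_actB _ _ _ h := h
  conj_verticial g v H hH := by
    refine ⟨H.map (MulAut.conj g).toMonoidHom, conj_mem_verticialSubgroups c hH g, ?_⟩
    simp [conjSubgroup, Subgroup.map_id]
  conj_edgeLike g e K hK := by
    refine ⟨K.map (MulAut.conj g).toMonoidHom, conj_mem_edgeLikeSubgroups' c hK g, ?_⟩
    simp [conjSubgroup, Subgroup.map_id]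
  exists_open_trivial := ⟨⊤, by simp, fun _ _ => ⟨fun _ => rfl, fun _ => rfl, fun _ => rfl⟩⟩
  conj_branchPair g b v hb φ hφ x hb' := by
    refine ⟨φ, hφ, g * x, conjSubgroup_map_conj_map_id g x _, ?_⟩
    cases Subsingleton.elim hb hb'
    exact conjSubgroup_map_conj_map_id g x _

/-! ### The clause with the abutment argument fed by `abuts_actB` -/

/-- (BR) with the abutment of the image branch supplied by the package's own `abuts_actB`
(abc-iut-w4-d053 gen 0's convenience form of p417328, restored after the gen-2 resubmission
p417390 of this file dropped it; consumers: abc-iut-w4-d040's (c1)–(c3)).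
[cite: MochizukiSemiAnbd2006, Def 5.1 (i), p. 62] -/
theorem ArithChartBranchAction.conj_branchPair' {c : TemperedPiChart 𝒢} {Gtp : Type u'} [Group Gtp]
    {ι : c.G →* Gtp} {PA : Type u''} [Group PA] [TopologicalSpace PA] {aug : Gtp →* PA}
    {actV : PA → 𝒢.graph.Vertex → 𝒢.graph.Vertex} {actE : PA → 𝒢.graph.Edge → 𝒢.graph.Edge}
    {actB : PA → 𝒢.graph.Branch → 𝒢.graph.Branch}
    (A : ArithChartBranchAction c ι aug actV actE actB) (g : Gtp) (b : 𝒢.graph.Branch)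
    (v : 𝒢.graph.Vertex) (hb : 𝒢.graph.abuts b = some v) (φ : 𝒢.Gv v →ₜ* c.G)
    (hφ : IsVerticialHom c v φ) (x : c.G) :
    ∃ φ' : 𝒢.Gv (actV (aug g) v) →ₜ* c.G, IsVerticialHom c (actV (aug g) v) φ' ∧
      ∃ x' : c.G,
        conjSubgroup g ((φ.toMonoidHom.range.map (MulAut.conj x).toMonoidHom).map ι) =
          (φ'.toMonoidHom.range.map (MulAut.conj x').toMonoidHom).map ι ∧
        conjSubgroup g
            ((((𝒢.branchSubgroup b v hb).map φ.toMonoidHom).map (MulAut.conj x).toMonoidHom).map ι) =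
          (((𝒢.branchSubgroup (actB (aug g) b) (actV (aug g) v) (A.abuts_actB (aug g) b v hb)).map
            φ'.toMonoidHom).map (MulAut.conj x').toMonoidHom).map ι :=
  A.conj_branchPair g b v hb φ hφ x (A.abuts_actB (aug g) b v hb)

end ProfiniteSemiGraph

end Literature.AnabelianGeometry.SemiGraphs
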